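import Mathlib
import HarnessLib
import Summits.Ventures.LatticeQCDFlow.Scoring.BatchMeansCovariance
import Summits.Ventures.LatticeQCDFlow.Scoring.GeometricEnvelopeBlockSumMoments
import Summits.Ventures.LatticeQCDFlow.Scoring.GeometricEnvelopeDecorrelation

/-!
# The covariance structure of the squared batch sums under a GEOMETRIC SUP-NORM ENVELOPE, from any
# start: `Var(U_j) ≤ K₄` and `|Cov(U_j, U_k)| ≤ K₅ ρ^{|j−k|}/b` uniformly in the initial law

HONEST FRAMING: exact (Metropolis-corrected) sampling algorithms for lattice gauge theory;
figures of merit are autocorrelation/cost numbers at stated couplings and volumes; no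
continuum-physics claim.

Venture `LatticeQCDFlow` (cell pub-lqcd), topic `Scoring`; FANOUT row 8 (`s0-cpn-nemc`, GEN-20).
NEW WORK of the cell, not a published result; no definition is introduced; nothing is cited as a
fact.  Setting: `κ` Markov with a probability law `π` and a GEOMETRIC SUP-NORM ENVELOPE
`|(kop κ)^[t] g (x) − ∫ g dπ| ≤ 2 C_g A ρ^t` for every bounded measurable `g` (`0 ≤ ρ < 1`) — the
consequence of every one-step or `m`-step Doeblin certificate of the venture
(`Scoring/DoeblinPowerGeometricEnvelope.lean`); `|f| ≤ C` measurable, `f̄ = f − πf`; `P_{μ₀}` the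
chain's path law from ANY initial law.  Along the run the `j`-th BATCH of length `b` is
`X_{bj}, …, X_{bj+b−1}`; `S_j = Σ_{i<b} f̄(X_{bj+i})`, `U_j = S_j²/b`.  This is GEN-19's
`Scoring/BatchMeansCovariance.lean` (one-step minorisation) re-proved verbatim from the envelope: the
diagonal by the fourth-moment bound (`Scoring/GeometricEnvelopeBlockSumMoments.lean`:
`E U_j² ≤ K₄ = 512 C_h⁴`, `C_h = 4CA/(1−ρ)`), the off-diagonal by the block decorrelation
(`Scoring/GeometricEnvelopeDecorrelation.chain_dependsOn_blockSq_decorrelation_of_envelope` with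
`G = U_j` and the later batch `k > j` starting `b(k−j−1)+1 ≥ k−j` steps after:
`|E[U_j U_k] − E U_j E U_k| ≤ K_dec · 10 C_h² · ρ^{k−j}/b`, `K_dec = 8 (2C)² A² (1+ρ)/(1−ρ)²`).  The
`a × a` sum and the consistency of the batch-means estimator are
`Scoring/BatchMeansVarianceEnvelope.lean` / `Scoring/BatchMeansConsistencyEnvelope.lean`.
Printed counterpart NAMED ONLY: consistency of non-overlapping batch means (Glynn–Whitt 1991;
Damerdji 1994; Flegal–Jones 2010).

## Content (hypotheses as above; `b ≥ 1`; `K₄ = 512 C_h⁴`, `K₂ = 10 C_h²`, `C_h = 4CA/(1−ρ)`,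
## `K_dec = 8 (2C)² A² (1+ρ)/(1−ρ)²`; the bookkeeping `batchSum_dependsOn`, `batchSq_bounded_measurable`
## is GEN-19's)

* **`chain_batchSq_sq_le_of_envelope`** — `E_{μ₀}[U_j²] ≤ K₄`;
* **`chain_batchSq_offdiag_le_of_envelope`** — `j < k`: `|E[U_j U_k] − E[U_j] E[U_k]| ≤ K_dec K₂ ρ^{k−j}/b`;
* **`chain_batchSq_cov_le_of_envelope`** — all `j, k`:
  `|E[U_j U_k] − E[U_j] E[U_k]| ≤ K₄ · 1{j = k} + (K_dec K₂ / b) ρ^{|j−k|}`.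

NOT CLAIMED: sharp constants or rates; overlapping batches; unbounded observables.
-/

noncomputable section

namespace Summit.Ventures.LatticeQCDFlow.Scoring

open MeasureTheory ProbabilityTheory Filter Finset Preorder Literature.Probability.MarkovChains
open scoped ENNReal Topology

variable {Ω : Type*} [MeasurableSpace Ω]

/-! ### Second-order structure of the squared batch sums -/

section Covariance

variable {κ : Kernel Ω Ω} [IsMarkovKernel κ] {π : Measure Ω} [IsProbabilityMeasure π] {A ρ : ℝ}

/-- **Diagonal: `E_{μ₀}[U_j²] ≤ 512 (4C/e)⁴`** (`b ≥ 1`), from the fourth-moment bound. -/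
theorem chain_batchSq_sq_le_of_envelope (henv : ∀ (g : Ω → ℝ), Measurable g → ∀ (Cg : ℝ), (∀ x, |g x| ≤ Cg) →
      ∀ (t : ℕ) (x : Ω), |(kop κ)^[t] g x - ∫ y, g y ∂π| ≤ 2 * Cg * (A * ρ ^ t))
    (hρ0 : 0 ≤ ρ) (hρ1 : ρ < 1)
    {f : Ω → ℝ} (hf : Measurable f) {C : ℝ} (hC : ∀ x, |f x| ≤ C)
    (μ₀ : Measure Ω) [IsProbabilityMeasure μ₀] {b : ℕ} (hb : b ≠ 0) (j : ℕ) :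
    ∫ x, ((∑ i ∈ Finset.range b, (f (x (b * j + i)) - ∫ z, f z ∂π)) ^ 2 / b) ^ 2
        ∂(Kernel.trajMeasure (X := fun _ : ℕ => Ω) μ₀
          (fun n : ℕ => κ.comap (fun h : (i : ↥(Finset.Iic n)) → Ω => h ⟨n, Finset.mem_Iic.2 le_rfl⟩)
            (measurable_pi_apply _)))
      ≤ 512 * (4 * C * A / (1 - ρ)) ^ 4 := by
  have h4 := chain_blockSum_fourth_le_of_envelope henv hρ0 hρ1 hf hC μ₀ (b * j) hb
  have hb0 : (0 : ℝ) < b := Nat.cast_pos.2 (Nat.pos_of_ne_zero hb)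
  have hpt : ∀ x : ℕ → Ω, ((∑ i ∈ Finset.range b, (f (x (b * j + i)) - ∫ z, f z ∂π)) ^ 2 / b) ^ 2
      = (∑ i ∈ Finset.range b, (f (x (b * j + i)) - ∫ z, f z ∂π)) ^ 4 / (b : ℝ) ^ 2 := fun x => by
    rw [div_pow, ← pow_mul]
  rw [integral_congr_ae (ae_of_all _ hpt), integral_div]
  calc (∫ x, (∑ i ∈ Finset.range b, (f (x (b * j + i)) - ∫ z, f z ∂π)) ^ 4
        ∂(Kernel.trajMeasure (X := fun _ : ℕ => Ω) μ₀
          (fun n : ℕ => κ.comap (fun h : (i : ↥(Finset.Iic n)) → Ω => h ⟨n, Finset.mem_Iic.2 le_rfl⟩)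
            (measurable_pi_apply _)))) / (b : ℝ) ^ 2
      ≤ (512 * (4 * C * A / (1 - ρ)) ^ 4 * (b : ℝ) ^ 2) / (b : ℝ) ^ 2 :=
        div_le_div_of_nonneg_right h4 (by positivity)
    _ = 512 * (4 * C * A / (1 - ρ)) ^ 4 := by field_simp

/-- **Off-diagonal: for `j < k`, `|E[U_j U_k] − E[U_j] E[U_k]| ≤ K_dec K₂ ρ^{k−j} / b`** with
`K_dec = 4 (2C)² (1+ρ)/(1−ρ)²`, `K₂ = 10 (4C/e)²` — the later batch starts `b(k−j−1)+1 ≥ k−j` steps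
after the earlier one ends. -/
theorem chain_batchSq_offdiag_le_of_envelope (henv : ∀ (g : Ω → ℝ), Measurable g → ∀ (Cg : ℝ), (∀ x, |g x| ≤ Cg) →
      ∀ (t : ℕ) (x : Ω), |(kop κ)^[t] g x - ∫ y, g y ∂π| ≤ 2 * Cg * (A * ρ ^ t))
    (hρ0 : 0 ≤ ρ) (hρ1 : ρ < 1)
    {f : Ω → ℝ} (hf : Measurable f) {C : ℝ} (hC : ∀ x, |f x| ≤ C)
    (μ₀ : Measure Ω) [IsProbabilityMeasure μ₀] {b : ℕ} (hb : b ≠ 0) {j k : ℕ} (hjk : j < k) :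
    |∫ x, ((∑ i ∈ Finset.range b, (f (x (b * j + i)) - ∫ z, f z ∂π)) ^ 2 / b)
          * ((∑ i ∈ Finset.range b, (f (x (b * k + i)) - ∫ z, f z ∂π)) ^ 2 / b)
        ∂(Kernel.trajMeasure (X := fun _ : ℕ => Ω) μ₀
          (fun n : ℕ => κ.comap (fun h : (i : ↥(Finset.Iic n)) → Ω => h ⟨n, Finset.mem_Iic.2 le_rfl⟩)
            (measurable_pi_apply _)))
      - (∫ x, (∑ i ∈ Finset.range b, (f (x (b * j + i)) - ∫ z, f z ∂π)) ^ 2 / b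
        ∂(Kernel.trajMeasure (X := fun _ : ℕ => Ω) μ₀
          (fun n : ℕ => κ.comap (fun h : (i : ↥(Finset.Iic n)) → Ω => h ⟨n, Finset.mem_Iic.2 le_rfl⟩)
            (measurable_pi_apply _))))
        * ∫ x, (∑ i ∈ Finset.range b, (f (x (b * k + i)) - ∫ z, f z ∂π)) ^ 2 / b
        ∂(Kernel.trajMeasure (X := fun _ : ℕ => Ω) μ₀
          (fun n : ℕ => κ.comap (fun h : (i : ↥(Finset.Iic n)) → Ω => h ⟨n, Finset.mem_Iic.2 le_rfl⟩)
            (measurable_pi_apply _)))|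
      ≤ 8 * (2 * C) ^ 2 * A ^ 2 * ((1 + ρ) / (1 - ρ) ^ 2)
        * (10 * (4 * C * A / (1 - ρ)) ^ 2) * ρ ^ (k - j) / b := by
  set P := Kernel.trajMeasure (X := fun _ : ℕ => Ω) μ₀
      (fun n : ℕ => κ.comap (fun h : (i : ↥(Finset.Iic n)) → Ω => h ⟨n, Finset.mem_Iic.2 le_rfl⟩)
        (measurable_pi_apply _)) with hP
  set c := ∫ z, f z ∂π with hc
  obtain ⟨hfb, hCfb, -⟩ := centred_observable_bounds π hf hC
  obtain ⟨b', rfl⟩ : ∃ b', b = b' + 1 := ⟨b - 1, (Nat.succ_pred_eq_of_pos (Nat.pos_of_ne_zero hb)).symm⟩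
  obtain ⟨m, rfl⟩ : ∃ m, k = j + m + 1 := ⟨k - j - 1, by omega⟩
  have hb0 : (0 : ℝ) < ((b' + 1 : ℕ) : ℝ) := Nat.cast_pos.2 (Nat.succ_pos b')
  -- `G = U_j`
  obtain ⟨hGm, hGb⟩ := batchSq_bounded_measurable hfb hCfb (b' + 1) j
  have hGd : DependsOn (fun x : ℕ → Ω =>
      (∑ i ∈ Finset.range (b' + 1), (f (x ((b' + 1) * j + i)) - c)) ^ 2 / ((b' + 1 : ℕ) : ℝ))
      (Set.Iic ((b' + 1) * j + b')) := by
    intro x y hxy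
    exact congrArg (fun t : ℝ => t ^ 2 / ((b' + 1 : ℕ) : ℝ))
      (batchSum_dependsOn (fun z => f z - c) b' j hxy)
  -- the decorrelation with gap `g = (b'+1) m + 1`
  have key := chain_dependsOn_blockSq_decorrelation_of_envelope μ₀ henv hρ0 hρ1 hf hC
    ((b' + 1) * j + b') ((b' + 1) * m + 1) (b' + 1) hGm hGd hGb
  rw [← hP] at key
  -- the later block is the `k`-th batch
  have hidx : ∀ l, (b' + 1) * j + b' + ((b' + 1) * m + 1) + l = (b' + 1) * (j + m + 1) + l :=
    fun l => by ring
  simp only [hidx] at key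
  -- `∫ |U_j| = E[S_j²]/b ≤ K₂`
  have hS2 := chain_blockSum_sq_le_of_envelope henv hρ0 hρ1 hf hC μ₀ ((b' + 1) * j)
    (Nat.succ_ne_zero b')
  rw [← hP] at hS2
  have hIG : ∫ x, |(∑ i ∈ Finset.range (b' + 1), (f (x ((b' + 1) * j + i)) - c)) ^ 2
      / ((b' + 1 : ℕ) : ℝ)| ∂P ≤ 10 * (4 * C * A / (1 - ρ)) ^ 2 := by
    have habs : ∀ x : ℕ → Ω, |(∑ i ∈ Finset.range (b' + 1), (f (x ((b' + 1) * j + i)) - c)) ^ 2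
        / ((b' + 1 : ℕ) : ℝ)|
        = (∑ i ∈ Finset.range (b' + 1), (f (x ((b' + 1) * j + i)) - c)) ^ 2 / ((b' + 1 : ℕ) : ℝ) :=
      fun x => abs_of_nonneg (div_nonneg (sq_nonneg _) hb0.le)
    rw [integral_congr_ae (ae_of_all _ habs), integral_div]
    calc (∫ x, (∑ i ∈ Finset.range (b' + 1), (f (x ((b' + 1) * j + i)) - c)) ^ 2 ∂P)
          / ((b' + 1 : ℕ) : ℝ)
        ≤ (10 * (4 * C * A / (1 - ρ)) ^ 2 * ((b' + 1 : ℕ) : ℝ)) / ((b' + 1 : ℕ) : ℝ) :=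
          div_le_div_of_nonneg_right hS2 hb0.le
      _ = 10 * (4 * C * A / (1 - ρ)) ^ 2 := by field_simp
  -- divide the decorrelation by `b` (the `k`-th factor is `S_k²/b`)
  have hKdec0 : 0 ≤ 8 * (2 * C) ^ 2 * A ^ 2 * ((1 + ρ) / (1 - ρ) ^ 2) * ρ ^ ((b' + 1) * m + 1) := by
    have : 0 ≤ (1 + ρ) / (1 - ρ) ^ 2 := div_nonneg (by linarith) (sq_nonneg _)
    positivity
  have key' := mul_le_mul_of_nonneg_left hIG hKdec0
  have key2 := key.trans key'
  -- rewrite the products with `/ b`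
  have hL : ∫ x, (∑ i ∈ Finset.range (b' + 1), (f (x ((b' + 1) * j + i)) - c)) ^ 2 / ((b' + 1 : ℕ) : ℝ)
        * ((∑ i ∈ Finset.range (b' + 1), (f (x ((b' + 1) * (j + m + 1) + i)) - c)) ^ 2
          / ((b' + 1 : ℕ) : ℝ)) ∂P
      = (∫ x, (∑ i ∈ Finset.range (b' + 1), (f (x ((b' + 1) * j + i)) - c)) ^ 2 / ((b' + 1 : ℕ) : ℝ)
        * (∑ i ∈ Finset.range (b' + 1), (f (x ((b' + 1) * (j + m + 1) + i)) - c)) ^ 2 ∂P)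
        / ((b' + 1 : ℕ) : ℝ) := by
    rw [← integral_div]
    exact integral_congr_ae (ae_of_all _ fun x => by ring)
  have hR : ∫ x, (∑ i ∈ Finset.range (b' + 1), (f (x ((b' + 1) * (j + m + 1) + i)) - c)) ^ 2
        / ((b' + 1 : ℕ) : ℝ) ∂P
      = (∫ x, (∑ i ∈ Finset.range (b' + 1), (f (x ((b' + 1) * (j + m + 1) + i)) - c)) ^ 2 ∂P)
        / ((b' + 1 : ℕ) : ℝ) := integral_div _ _
  rw [hL, hR]
  have hdist : j + m + 1 - j = m + 1 := by omega
  rw [hdist]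
  have hρg : ρ ^ ((b' + 1) * m + 1) ≤ ρ ^ (m + 1) :=
    pow_le_pow_of_le_one hρ0 hρ1.le (by nlinarith [Nat.zero_le (b' * m)])
  have hfinal : |(∫ x, (∑ i ∈ Finset.range (b' + 1), (f (x ((b' + 1) * j + i)) - c)) ^ 2
        / ((b' + 1 : ℕ) : ℝ)
        * (∑ i ∈ Finset.range (b' + 1), (f (x ((b' + 1) * (j + m + 1) + i)) - c)) ^ 2 ∂P)
        / ((b' + 1 : ℕ) : ℝ)
      - (∫ x, (∑ i ∈ Finset.range (b' + 1), (f (x ((b' + 1) * j + i)) - c)) ^ 2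
        / ((b' + 1 : ℕ) : ℝ) ∂P)
        * ((∫ x, (∑ i ∈ Finset.range (b' + 1), (f (x ((b' + 1) * (j + m + 1) + i)) - c)) ^ 2 ∂P)
          / ((b' + 1 : ℕ) : ℝ))|
      = |∫ x, (∑ i ∈ Finset.range (b' + 1), (f (x ((b' + 1) * j + i)) - c)) ^ 2
          / ((b' + 1 : ℕ) : ℝ)
          * (∑ i ∈ Finset.range (b' + 1), (f (x ((b' + 1) * (j + m + 1) + i)) - c)) ^ 2 ∂P
        - (∫ x, (∑ i ∈ Finset.range (b' + 1), (f (x ((b' + 1) * j + i)) - c)) ^ 2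
          / ((b' + 1 : ℕ) : ℝ) ∂P)
          * ∫ x, (∑ i ∈ Finset.range (b' + 1), (f (x ((b' + 1) * (j + m + 1) + i)) - c)) ^ 2 ∂P|
        / ((b' + 1 : ℕ) : ℝ) := by
    rw [← abs_of_pos hb0, ← abs_div, abs_of_pos hb0]
    congr 1
    field_simp
  rw [hfinal]
  refine (div_le_div_of_nonneg_right key2 hb0.le).trans ?_
  refine div_le_div_of_nonneg_right ?_ hb0.le
  have h10 : 0 ≤ 10 * (4 * C * A / (1 - ρ)) ^ 2 := by positivity
  have hK0 : 0 ≤ 8 * (2 * C) ^ 2 * A ^ 2 * ((1 + ρ) / (1 - ρ) ^ 2) := by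
    have : 0 ≤ (1 + ρ) / (1 - ρ) ^ 2 := div_nonneg (by linarith) (sq_nonneg _)
    positivity
  calc 8 * (2 * C) ^ 2 * A ^ 2 * ((1 + ρ) / (1 - ρ) ^ 2) * ρ ^ ((b' + 1) * m + 1) * (10 * (4 * C * A / (1 - ρ)) ^ 2)
      ≤ 8 * (2 * C) ^ 2 * A ^ 2 * ((1 + ρ) / (1 - ρ) ^ 2) * ρ ^ (m + 1) * (10 * (4 * C * A / (1 - ρ)) ^ 2) :=
        mul_le_mul_of_nonneg_right (mul_le_mul_of_nonneg_left hρg hK0) h10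
    _ = 8 * (2 * C) ^ 2 * A ^ 2 * ((1 + ρ) / (1 - ρ) ^ 2) * (10 * (4 * C * A / (1 - ρ)) ^ 2) * ρ ^ (m + 1) := by
        ring

/-- **All pairs: `|E[U_j U_k] − E[U_j] E[U_k]| ≤ K₄ · 1{j = k} + (K_dec K₂ / b) ρ^{|j − k|}`.** -/
theorem chain_batchSq_cov_le_of_envelope (henv : ∀ (g : Ω → ℝ), Measurable g → ∀ (Cg : ℝ), (∀ x, |g x| ≤ Cg) →
      ∀ (t : ℕ) (x : Ω), |(kop κ)^[t] g x - ∫ y, g y ∂π| ≤ 2 * Cg * (A * ρ ^ t))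
    (hρ0 : 0 ≤ ρ) (hρ1 : ρ < 1)
    {f : Ω → ℝ} (hf : Measurable f) {C : ℝ} (hC : ∀ x, |f x| ≤ C)
    (μ₀ : Measure Ω) [IsProbabilityMeasure μ₀] {b : ℕ} (hb : b ≠ 0) (j k : ℕ) :
    |∫ x, ((∑ i ∈ Finset.range b, (f (x (b * j + i)) - ∫ z, f z ∂π)) ^ 2 / b)
          * ((∑ i ∈ Finset.range b, (f (x (b * k + i)) - ∫ z, f z ∂π)) ^ 2 / b)
        ∂(Kernel.trajMeasure (X := fun _ : ℕ => Ω) μ₀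
          (fun n : ℕ => κ.comap (fun h : (i : ↥(Finset.Iic n)) → Ω => h ⟨n, Finset.mem_Iic.2 le_rfl⟩)
            (measurable_pi_apply _)))
      - (∫ x, (∑ i ∈ Finset.range b, (f (x (b * j + i)) - ∫ z, f z ∂π)) ^ 2 / b
        ∂(Kernel.trajMeasure (X := fun _ : ℕ => Ω) μ₀
          (fun n : ℕ => κ.comap (fun h : (i : ↥(Finset.Iic n)) → Ω => h ⟨n, Finset.mem_Iic.2 le_rfl⟩)
            (measurable_pi_apply _))))
        * ∫ x, (∑ i ∈ Finset.range b, (f (x (b * k + i)) - ∫ z, f z ∂π)) ^ 2 / b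
        ∂(Kernel.trajMeasure (X := fun _ : ℕ => Ω) μ₀
          (fun n : ℕ => κ.comap (fun h : (i : ↥(Finset.Iic n)) → Ω => h ⟨n, Finset.mem_Iic.2 le_rfl⟩)
            (measurable_pi_apply _)))|
      ≤ 512 * (4 * C * A / (1 - ρ)) ^ 4 * (if j = k then 1 else 0)
        + 8 * (2 * C) ^ 2 * A ^ 2 * ((1 + ρ) / (1 - ρ) ^ 2)
          * (10 * (4 * C * A / (1 - ρ)) ^ 2) / b * ρ ^ (Nat.dist j k) := by
  set P := Kernel.trajMeasure (X := fun _ : ℕ => Ω) μ₀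
      (fun n : ℕ => κ.comap (fun h : (i : ↥(Finset.Iic n)) → Ω => h ⟨n, Finset.mem_Iic.2 le_rfl⟩)
        (measurable_pi_apply _)) with hP
  set c := ∫ z, f z ∂π with hc
  have hb0 : (0 : ℝ) < b := Nat.cast_pos.2 (Nat.pos_of_ne_zero hb)
  have hoff0 : 0 ≤ 8 * (2 * C) ^ 2 * A ^ 2 * ((1 + ρ) / (1 - ρ) ^ 2) * (10 * (4 * C * A / (1 - ρ)) ^ 2) / b
      * ρ ^ (Nat.dist j k) := by
    have : 0 ≤ (1 + ρ) / (1 - ρ) ^ 2 := div_nonneg (by linarith) (sq_nonneg _)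
    positivity
  rcases lt_trichotomy j k with hjk | rfl | hkj
  · -- `j < k`
    have h := chain_batchSq_offdiag_le_of_envelope henv hρ0 hρ1 hf hC μ₀ hb hjk
    rw [← hP] at h
    rw [if_neg hjk.ne, mul_zero, zero_add, Nat.dist_eq_sub_of_le hjk.le]
    exact h.trans (le_of_eq (by ring))
  · -- `j = k`: the variance is at most the second moment
    rw [if_pos rfl, mul_one, Nat.dist_self, pow_zero, mul_one]
    obtain ⟨hfb, hCfb, -⟩ := centred_observable_bounds π hf hC
    obtain ⟨hUm, hUb⟩ := batchSq_bounded_measurable hfb hCfb b j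
    have hsq := chain_batchSq_sq_le_of_envelope henv hρ0 hρ1 hf hC μ₀ hb j
    rw [← hP] at hsq
    have hU2 : ∫ x, (∑ i ∈ Finset.range b, (f (x (b * j + i)) - c)) ^ 2 / b
        * ((∑ i ∈ Finset.range b, (f (x (b * j + i)) - c)) ^ 2 / b) ∂P
        = ∫ x, ((∑ i ∈ Finset.range b, (f (x (b * j + i)) - c)) ^ 2 / b) ^ 2 ∂P :=
      integral_congr_ae (ae_of_all _ fun x => by ring)
    rw [hU2]
    have hm0 : 0 ≤ ∫ x, (∑ i ∈ Finset.range b, (f (x (b * j + i)) - c)) ^ 2 / b ∂P :=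
      integral_nonneg fun x => div_nonneg (sq_nonneg _) hb0.le
    have hE2 : 0 ≤ ∫ x, ((∑ i ∈ Finset.range b, (f (x (b * j + i)) - c)) ^ 2 / b) ^ 2 ∂P :=
      integral_nonneg fun x => sq_nonneg _
    -- `(E U)² ≤ E[U²]`
    have hJ := sq_integral_le_integral_sq P hUm hUb
    rw [← hc] at hsq hJ
    have hK4 : 0 ≤ 512 * (4 * C * A / (1 - ρ)) ^ 4 := by positivity
    have hK5 : 0 ≤ 8 * (2 * C) ^ 2 * A ^ 2 * ((1 + ρ) / (1 - ρ) ^ 2) * (10 * (4 * C * A / (1 - ρ)) ^ 2) / b := by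
      have : 0 ≤ (1 + ρ) / (1 - ρ) ^ 2 := div_nonneg (by linarith) (sq_nonneg _)
      positivity
    rw [abs_le]
    constructor
    · nlinarith [mul_self_nonneg (∫ x, (∑ i ∈ Finset.range b, (f (x (b * j + i)) - c)) ^ 2 / b ∂P)]
    · nlinarith [mul_self_nonneg (∫ x, (∑ i ∈ Finset.range b, (f (x (b * j + i)) - c)) ^ 2 / b ∂P)]
  · -- `k < j`: symmetry
    have h := chain_batchSq_offdiag_le_of_envelope henv hρ0 hρ1 hf hC μ₀ hb hkj
    rw [← hP] at h
    rw [if_neg hkj.ne', mul_zero, zero_add, Nat.dist_comm, Nat.dist_eq_sub_of_le hkj.le]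
    have hsym1 : ∫ x, (∑ i ∈ Finset.range b, (f (x (b * j + i)) - c)) ^ 2 / b
        * ((∑ i ∈ Finset.range b, (f (x (b * k + i)) - c)) ^ 2 / b) ∂P
        = ∫ x, (∑ i ∈ Finset.range b, (f (x (b * k + i)) - c)) ^ 2 / b
        * ((∑ i ∈ Finset.range b, (f (x (b * j + i)) - c)) ^ 2 / b) ∂P :=
      integral_congr_ae (ae_of_all _ fun x => by ring)
    rw [hsym1, mul_comm (∫ x, (∑ i ∈ Finset.range b, (f (x (b * j + i)) - c)) ^ 2 / b ∂P)]
    exact h.trans (le_of_eq (by ring))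

end Covariance

end Summit.Ventures.LatticeQCDFlow.Scoring

end
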